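import Literature.NumberTheory.EllipticCurves.ZpExtensionEisensteinDVRSettingResidualCompatProofs
import Literature.NumberTheory.EllipticCurves.ZpExtensionEisensteinTwistDualityFormSignProofs
import HarnessLib

/-!
# `SatisfiesH.h5c` for the curve's Eisenstein setting: Howard's H.5(c) `(s^τ, t^τ) ≡ (s, t)^τ = −(s, t) (mod 𝔪)` for any
# H.4 data whose pairings are the Eisenstein duality forms of `E`-level forms anti-invariant under `τ_*` (proofs file)

Topic `NumberTheory/EllipticCurves` (cell `pub/bsd-print-x9`, companion of `ZpExtensionEisensteinDVRSetting` (D1) and of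
`WeilConjugatePairingTowerProofs` (the `E`-level family)).  THEOREMS ONLY; no definition, no named fact, no instance,
no notation, no `sorry`.

Howard, §1.3 H.5(c) [arXiv:1202.6340 p. 7 L98 – p. 8 L1]: «if H.4 is assumed to hold then the residual pairing
`T̄ × T̄ → (R/𝔪)(1)` satisfies `(s^τ, t^τ) = (s, t)^τ`», `τ` acting on `(R/𝔪)(1)` by `χ(τ) = −1`; the tree types it as
`Howard2004.H5c D π̄ A`: for lifts `s', t'` of `θ(π̄ s), θ(π̄ t)` one has `e(s', t') ≡ −e(s, t) (mod 𝔪)`.  For the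
curve's setting `St := W.eisensteinDVRSetting κ hm S hpS hbad L hL hLS jbar cd D fs` (levels
`T^{(k)} = E_K[p^{k+1}] ⊗ A_{m,k+1}(ψ)`, residual presentation `π̄_k(c ⊗ P) = ε(c) · p^k P`, `G_ℚ`-structure `θ = τ_*`
on `E_K[p]`) and ANY duality data `D` whose pairings are the Eisenstein forms `e_𝔮 = eisensteinDualityForm hm (k+1) ẽ_{k+1}`
of `E`-level forms `ẽ_j : E_K[p^j] × E_K[p^j] → ℤ/p^j` (e.g. `D k := ZpExtension.eisensteinDualityDatum … ẽ_{k+1} …`,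
`eisensteinDualityDatum_e`):

* **`WeierstrassCurve.eisensteinDVRSetting_h5c_of`** — if `ẽ_j(τ_* a, τ_* b) = −ẽ_j(a, b)` at every level (the sign clause
  (iv) of `WeierstrassCurve.exists_conjPairing_tower`: the Weil pairing is `G_ℚ`-equivariant and `τ` inverts `μ_{p^∞}`), then
  `H5c (D k) (St.πbar k) (St.A k)` at every level — VERBATIM the `h5c` input of D1's
  `eisensteinDVRSettingTame_satisfiesH_of`.  Proof: `Θ = 1 ⊗ τ_*` lifts `θ = τ_*` through `π̄_k`
  (`eisensteinDVRSetting_πbar_coeffExtensionLinear_torsionMap`; `τ_*` is additive, so commutes with `p^k·`), `ker π̄_k =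
  𝔪 · T^{(k)}` (`isQuotientBy_eisensteinDVRSetting_πbar`), bilinear forms are constant modulo `𝔪` on `𝔪 T^{(k)}`-cosets
  (`LinearMap.bilin_sub_mem_of_sub_mem_smul_top`), and `e(Θ s, Θ t) = −e(s, t)` (`eisensteinDualityForm_conj_conj`).

Every statement carries the CONSUMER PREAMBLE of `ZpExtensionEisensteinDVRSetting`.  BSD is not proved by any of this.

References: [Howard2004HeegnerKolyvagin] §1.3 H.5(c) (arXiv p. 7 L98 – p. 8 L1), Rem. 1.3.2, proof of Prop. 2.1.3;
[GrossLMS1991] §5 (5.1) (the action of `τ` on `E(K̄)`).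
-/

set_option autoImplicit false

noncomputable section

open Function NumberField IsDedekindDomain Field
open scoped NumberField ContRepresentation TensorProduct Classical

/-! ## §0 Generic: a bilinear form is constant modulo `I` on `I M`-cosets -/

/-- For an `R`-bilinear form `e` on `M` and an ideal `I`: `e(u, t) ∈ I` and `e(t, u) ∈ I` whenever `u ∈ I · M`.
[cite: Howard2004HeegnerKolyvagin, §1.3 H.5(c) (the residual pairing `T̄ × T̄ → R/𝔪` is well defined)] -/
theorem LinearMap.bilin_mem_of_mem_smul_top {R M : Type*} [CommRing R] [AddCommGroup M] [Module R M] (I : Ideal R)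
    (e : M →ₗ[R] M →ₗ[R] R) {u : M} (hu : u ∈ I • (⊤ : Submodule R M)) (t : M) : e u t ∈ I ∧ e t u ∈ I := by
  refine Submodule.smul_induction_on hu (fun r hr n _ ↦ ?_) (fun x y hx hy ↦ ?_)
  · rw [map_smul, LinearMap.smul_apply, map_smul, smul_eq_mul, smul_eq_mul]
    exact ⟨I.mul_mem_right _ hr, I.mul_mem_right _ hr⟩
  · rw [map_add, LinearMap.add_apply, map_add]
    exact ⟨I.add_mem hx.1 hy.1, I.add_mem hx.2 hy.2⟩

/-- Consequently `e(s', t') − e(s, t) ∈ I` whenever `s' − s, t' − t ∈ I · M` (the residual pairing modulo `I` depends only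
on the classes). [cite: Howard2004HeegnerKolyvagin, §1.3 H.5(c)] -/
theorem LinearMap.bilin_sub_mem_of_sub_mem_smul_top {R M : Type*} [CommRing R] [AddCommGroup M] [Module R M]
    (I : Ideal R) (e : M →ₗ[R] M →ₗ[R] R) {s s' t t' : M} (hs : s' - s ∈ I • (⊤ : Submodule R M))
    (ht : t' - t ∈ I • (⊤ : Submodule R M)) : e s' t' - e s t ∈ I := by
  have h : e s' t' - e s t = e (s' - s) t' + e s (t' - t) := by
    rw [map_sub, LinearMap.sub_apply, map_sub]; abel
  rw [h]
  exact I.add_mem (LinearMap.bilin_mem_of_mem_smul_top I e hs t').1 (LinearMap.bilin_mem_of_mem_smul_top I e ht s).2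

namespace WeierstrassCurve

open Literature.NumberTheory.EllipticCurves Literature.NumberTheory.GaloisRepresentations
open Literature.NumberTheory.GaloisRepresentations.DiscreteGaloisModule
open Literature.NumberTheory.GaloisCohomology.Howard2004
open Literature.NumberTheory.EllipticCurves.ZpExtension (EisensteinLevel)

variable {K : Type} [Field K] [NumberField K] (W : WeierstrassCurve ℚ) [W.IsElliptic] {p : ℕ} [hp : Fact p.Prime]
  (κ : ZpExtension K p) {m : ℕ} (hm : 1 ≤ m)
  (S : Finset (HeightOneSpectrum (𝓞 K)))
  (hpS : ∀ v : HeightOneSpectrum (𝓞 K), ((p : ℕ) : 𝓞 K) ∈ v.asIdeal → v ∈ S)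
  (hbad : ∀ v : HeightOneSpectrum (𝓞 K), v ∉ S → ((p : ℕ) : 𝓞 K) ∉ v.asIdeal → (W.baseChange K).HasGoodReductionAt v)
  (L : Set (HeightOneSpectrum (𝓞 K)))
  (hL : letI := IwasawaAlgebra.isLocalRing_quotient_X_pow_add_C p hm
    L ⊆ (W.eisensteinTower κ hm).degreeTwoPrimes p)
  (hLS : ∀ v ∈ L, v ∉ S)
  (jbar : AlgebraicClosure K →+* ℂ) (cd : ConjugationDatum K)
  (D : letI := IwasawaAlgebra.isLocalRing_quotient_X_pow_add_C p hm
    ∀ k, DualityDatum p cd ((W.eisensteinTower κ hm).ρ k) (IwasawaAlgebra.EisensteinCoeff p m (k + 1)))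
  (fs : letI := IwasawaAlgebra.isLocalRing_quotient_X_pow_add_C p hm
    ∀ (k : ℕ) (n : Finset (HeightOneSpectrum (𝓞 K))) (v : HeightOneSpectrum (𝓞 K)),
      galoisCohomology ((W.eisensteinLevelQuot κ hm k n).toLocal (Sum.inr v)) 1 →+
        SingularQuotient (GaloisRep.toLocal v (W.eisensteinLevelQuot κ hm k n)) ⊗[ℤ] Gell v)

set_option maxHeartbeats 400000 in
set_option synthInstance.maxHeartbeats 80000 in
/-- **`Θ = 1 ⊗ τ_*` lifts `θ = τ_*` through the residual presentation: `π̄_k(Θ s) = θ(π̄_k s)`** on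
`T^{(k)} = E_K[p^{k+1}] ⊗ A_{m,k+1}` (on `c ⊗ P` both sides are `ε(c) · p^k · τ_* P`, `τ_*` being additive).
[cite: Howard2004HeegnerKolyvagin, §1.3 H.5(a),(c) and proof of Prop. 2.1.3] [cite: GrossLMS1991, §5 (5.1)] -/
theorem eisensteinDVRSetting_πbar_coeffExtensionLinear_torsionMap (k : ℕ)
    (s : IwasawaAlgebra.EisensteinCoeff.Twisted p m (k + 1) (geomTorsion (W.baseChange K) ((p : ℤ) ^ (k + 1)))) :
    letI := IwasawaAlgebra.isDomain_quotient_X_pow_add_C p hm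
    letI := IwasawaAlgebra.isDiscreteValuationRing_quotient_X_pow_add_C p hm
    haveI := IwasawaAlgebra.EisensteinCoeff.isLocalRing_succ p hm
    letI := IwasawaAlgebra.EisensteinCoeff.algebraOfSpecSucc p m
    haveI := W.isScalarTower_algebraOfSpecSucc (K := K) (p := p) (m := m)
    letI := W.residueModuleSucc (K := K) (p := p) hm
    (W.eisensteinDVRSetting κ hm S hpS hbad L hL hLS jbar cd D fs).πbar k
        (DiscreteGaloisModule.coeffExtensionLinear (IwasawaAlgebra.EisensteinCoeff p m (k + 1))
          (cd.isLift.torsionMap W ((p : ℤ) ^ (k + 1))).toIntLinearMap s) =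
      (W.residualTauGeomTorsion (p := p) cd hm (k := k + 1) k.succ_pos).θ
        ((W.eisensteinDVRSetting κ hm S hpS hbad L hL hLS jbar cd D fs).πbar k s) := by
  letI := IwasawaAlgebra.isDomain_quotient_X_pow_add_C p hm
  letI := IwasawaAlgebra.isDiscreteValuationRing_quotient_X_pow_add_C p hm
  haveI := IwasawaAlgebra.EisensteinCoeff.isLocalRing_succ p hm
  letI := IwasawaAlgebra.EisensteinCoeff.algebraOfSpecSucc p m
  haveI := W.isScalarTower_algebraOfSpecSucc (K := K) (p := p) (m := m)
  letI := W.residueModuleSucc (K := K) (p := p) hm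
  -- notation: the presentation `π̄_k`, the residual involution `θ = τ_*`, the lift `Θ = 1 ⊗ τ_*`
  set π := (W.eisensteinDVRSetting κ hm S hpS hbad L hL hLS jbar cd D fs).πbar k with hπ
  set θbar := (W.residualTauGeomTorsion (p := p) cd hm (k := k + 1) k.succ_pos).θ with hθbar
  set Θ := DiscreteGaloisModule.coeffExtensionLinear (IwasawaAlgebra.EisensteinCoeff p m (k + 1))
    (cd.isLift.torsionMap W ((p : ℤ) ^ (k + 1))).toIntLinearMap with hΘ
  induction s using IwasawaAlgebra.EisensteinCoeff.Twisted.induction_on with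
  | zero =>
    have h0 : Θ 0 = 0 := map_zero Θ
    have h1 : π (0 : IwasawaAlgebra.EisensteinCoeff.Twisted p m (k + 1) (geomTorsion (W.baseChange K) ((p : ℤ) ^ (k + 1)))) = 0 :=
      map_zero π
    rw [h0, h1]
    exact (map_zero θbar).symm
  | add x y hx hy =>
    calc π (Θ (x + y)) = π (Θ x) + π (Θ y) := by
          exact (congrArg π (map_add Θ x y)).trans (map_add π _ _)
      _ = θbar (π x) + θbar (π y) := by rw [hx, hy]
      _ = θbar (π (x + y)) := by
          exact ((congrArg θbar (map_add π x y)).trans (map_add θbar _ _)).symm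
  | tmul c P =>
    rw [hΘ, DiscreteGaloisModule.coeffExtensionLinear_tmul]
    apply Subtype.ext
    rw [hπ, W.coe_eisensteinDVRSetting_πbar_tmul' κ hm S hpS hbad L hL hLS jbar cd D fs k c _, hθbar,
      W.residualTauGeomTorsion_θ_apply (p := p) cd hm k.succ_pos, IsLiftOfAut.coe_torsionMap,
      W.coe_eisensteinDVRSetting_πbar_tmul' κ hm S hpS hbad L hL hLS jbar cd D fs k c P, map_nsmul, map_zsmul]
    rfl

set_option synthInstance.maxHeartbeats 80000 in
/-- **`SatisfiesH.h5c` for the Eisenstein setting**: if the pairings of the H.4 data `D` are the Eisenstein duality forms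
`eisensteinDualityForm hm (k+1) ẽ_{k+1}` of `E`-level forms with `ẽ_j(τ_* a, τ_* b) = −ẽ_j(a, b)` (the Weil–`τ` forms of
`exists_conjPairing_tower`), then Howard's H.5(c) holds at every level: for lifts `s', t'` of `τ_*(π̄ s), τ_*(π̄ t)`,
`e(s', t') ≡ −e(s, t) (mod 𝔪)`.
[cite: Howard2004HeegnerKolyvagin, §1.3 H.5(c) (arXiv p. 7 L98 – p. 8 L1) and Rem. 1.3.2] -/
theorem eisensteinDVRSetting_h5c_of
    (eb : ∀ j, geomTorsion (W.baseChange K) ((p : ℤ) ^ j) →+ geomTorsion (W.baseChange K) ((p : ℤ) ^ j) →+ ZMod (p ^ j))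
    (hD : letI := IwasawaAlgebra.isLocalRing_quotient_X_pow_add_C p hm
      ∀ k, (D k).e = ZpExtension.eisensteinDualityForm hm (k + 1) (eb (k + 1)))
    (hsign : ∀ j (a b : geomTorsion (W.baseChange K) ((p : ℤ) ^ j)),
      eb j (cd.isLift.torsionMap W _ a) (cd.isLift.torsionMap W _ b) = -eb j a b)
    (k : ℕ) :
    letI := IwasawaAlgebra.isDomain_quotient_X_pow_add_C p hm
    letI := IwasawaAlgebra.isDiscreteValuationRing_quotient_X_pow_add_C p hm
    haveI := IwasawaAlgebra.EisensteinCoeff.isLocalRing_succ p hm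
    letI := IwasawaAlgebra.EisensteinCoeff.algebraOfSpecSucc p m
    haveI := W.isScalarTower_algebraOfSpecSucc (K := K) (p := p) (m := m)
    letI := W.residueModuleSucc (K := K) (p := p) hm
    H5c (D k) ((W.eisensteinDVRSetting κ hm S hpS hbad L hL hLS jbar cd D fs).πbar k)
      (W.residualTauGeomTorsion (p := p) cd hm (k := k + 1) k.succ_pos) := by
  letI := IwasawaAlgebra.isDomain_quotient_X_pow_add_C p hm
  letI := IwasawaAlgebra.isDiscreteValuationRing_quotient_X_pow_add_C p hm
  haveI := IwasawaAlgebra.EisensteinCoeff.isLocalRing_succ p hm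
  letI := IwasawaAlgebra.EisensteinCoeff.algebraOfSpecSucc p m
  haveI := W.isScalarTower_algebraOfSpecSucc (K := K) (p := p) (m := m)
  letI := W.residueModuleSucc (K := K) (p := p) hm
  intro s t s' t' hs ht
  -- notation: the presentation `π̄_k` and the lift `Θ = 1 ⊗ τ_*` of `θ = τ_*`, read on the level carrier
  set π := (W.eisensteinDVRSetting κ hm S hpS hbad L hL hLS jbar cd D fs).πbar k with hπ
  let ΘN : EisensteinLevel p m (fun j ↦ geomTorsion (W.baseChange K) ((p : ℤ) ^ j)) (k + 1) →+
      EisensteinLevel p m (fun j ↦ geomTorsion (W.baseChange K) ((p : ℤ) ^ j)) (k + 1) :=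
    (DiscreteGaloisModule.coeffExtensionLinear (IwasawaAlgebra.EisensteinCoeff p m (k + 1))
      (cd.isLift.torsionMap W ((p : ℤ) ^ (k + 1))).toIntLinearMap).toAddMonoidHom
  have hker : LinearMap.ker π =
      IsLocalRing.maximalIdeal (IwasawaAlgebra.EisensteinCoeff p m (k + 1)) •
        (⊤ : Submodule (IwasawaAlgebra.EisensteinCoeff p m (k + 1))
          (EisensteinLevel p m (fun j ↦ geomTorsion (W.baseChange K) ((p : ℤ) ^ j)) (k + 1))) :=
    (W.isQuotientBy_eisensteinDVRSetting_πbar κ hm S hpS hbad L hL hLS jbar cd D fs k).ker_eq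
  -- the lifts differ from `Θ s`, `Θ t` by elements of `ker π̄ = 𝔪 T^{(k)}`
  have hlift : ∀ x x' : EisensteinLevel p m (fun j ↦ geomTorsion (W.baseChange K) ((p : ℤ) ^ j)) (k + 1),
      π x' = (W.residualTauGeomTorsion (p := p) cd hm (k := k + 1) k.succ_pos).θ (π x) →
        x' - ΘN x ∈ IsLocalRing.maximalIdeal (IwasawaAlgebra.EisensteinCoeff p m (k + 1)) •
          (⊤ : Submodule (IwasawaAlgebra.EisensteinCoeff p m (k + 1))
            (EisensteinLevel p m (fun j ↦ geomTorsion (W.baseChange K) ((p : ℤ) ^ j)) (k + 1))) := by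
    intro x x' hx
    have h1 : π (ΘN x) = (W.residualTauGeomTorsion (p := p) cd hm (k := k + 1) k.succ_pos).θ (π x) :=
      W.eisensteinDVRSetting_πbar_coeffExtensionLinear_torsionMap κ hm S hpS hbad L hL hLS jbar cd D fs k x
    rw [← hker, LinearMap.mem_ker, map_sub, hx, ← h1, sub_self]
  have hmod := LinearMap.bilin_sub_mem_of_sub_mem_smul_top _ (D k).e (hlift s s' hs) (hlift t t' ht)
  rw [← Ideal.Quotient.eq] at hmod
  rw [hmod, ← map_neg]
  congr 1
  -- `e(Θ s, Θ t) = −e(s, t)`: the pairings are the Eisenstein forms of `τ_*`-anti-invariant `E`-level forms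
  have hD' := congrArg (fun f ↦ f (ΘN s) (ΘN t)) (hD k)
  have hD'' := congrArg (fun f ↦ f s t) (hD k)
  rw [hD', hD'']
  exact ZpExtension.eisensteinDualityForm_conj_conj hm (k + 1) (eb (k + 1)) (cd.isLift.torsionMap W ((p : ℤ) ^ (k + 1)))
    (hsign (k + 1)) s t

end WeierstrassCurve

end
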